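import Summits.QuantumFields.YangMills.Theorems.UnitScaleTiltProp7CutoffLaplacianFormRows
import HarnessLib

/-!
# Route `UnitScaleTilt`, crux «MinimiserStabilityRegPr» (stmt-QuantumFields-19200, stub EX), EX row `hGF`[Lift] (curved member), the LOD line, ★p1 g24's `LOCATE-L6-ASSEMBLY`
# §1 Step I.2 pen (L5″) (routeR-w3 g12 «px5: (M) — GO») — **(M-II) THE MEMBER FORM ROWS OF THE CUT-OFF COMPARISON, MASS PART**: (M2′) the cutoff commutes with the mass term
# `a·T(ι(Q″·))` up to the IN-BLOCK OSCILLATION of `χ` — `|re⟪toL2S z, X(TιQ″(toL2S w)) − TιQ″(X(toL2S w))⟫| ≤ (25κ∕4)·θ′·‖toL2S z‖·‖toL2S w‖` when `|χ(x) − χ_c(B(x))| ≤ θ′`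
# (`Q″` commutes with block constants EXACTLY, ✓`topMean_blockConst_smul`; the block-constant lift is symmetric under real coarse multipliers; the remainder is `ιQ″((χ − χ_c∘B)·)`,
# bounded by ✓`normSq_lift_topMean_le`); (M3′-mass) the difference of the two mass terms on the cut-off vector under a DISPLAYED two-tower closeness row `δ_Q` ((L5c)-class);
# and the full `hform` row of ✓p750050 `norm_inv_cutoff_comm_le_of_form` for `A_U = Δ_U + aT_Uι Q″_U`, `A_V = Δ_V + aT_VιQ″_V` (ym3-torus-px5 g11).

Cell `ym3-torus` (HUMAN RULING D-0037: YM₃ on T³ is ladder rung R3 — NOT d = 4, NOT infinite volume, NOT a mass gap, NOT Clay).  Width seat `ym3-torus-px5` (gen 11; WIDTH COPY of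
ym3-torus-p1).  THEOREMS ONLY (0 `def`, 0 `sorry`); `--supports stmt-QuantumFields-19200 --as helper`, count-neutral.  HONEST LABEL (№33 (6)): curved γ-row supplier line (LOD
localisation); member letters for (L5″); the two-tower closeness `δ_Q` is DISPLAYED, not proved; nothing of (L5″), (L6), (3.49), `h349`, `hGF`, EX ∕ 19200 is proved.

WHAT IS PROVED (sorry-free, no definition; ns `…Theorems.Prop7CutoffMassFormRows`).
* §1 ★★`abs_re_inner_comm_mass_le` — (M2′) as displayed (at `RegPr F n K ε₀ V`, `10⁷L³ε₀ ≤ 1`; `κ = c₁((L^d)^{K−n})⁻¹∕c₀`).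
* §2 (v1.1) ★★`abs_re_inner_mass_sub_mass_le` — (M3′-mass) under the displayed two-tower rows `hQw`, `hQz`: `≤ 2√(25κ∕8)δ_Q‖z‖‖w‖`;
  ★★★`abs_re_inner_twisted_massive_le` — THE ONE EXPORTED `hform` ROW for the massive systems: `c₁' = c`, `c₀' = c + a((25κ∕4)θ′ + 2√(25κ∕8)δ_Q)`.
HONEST SCOPE.  Member bookkeeping over landed rows; nothing of (L5″)∕(L6), `hGF`, `h349`, EX or the crux is proved here.

References: T. Bałaban, CMP **99** (1985) 389–434 [Balaban1985BackgroundPropagators] ((3.16) p.393, (3.19) p.393, (3.24) p.394, (3.100)–(3.105) pp.413–414); CMP **98** (1985) 17–51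
[Balaban1985Averaging] ((97) p.32).
-/

set_option autoImplicit false

noncomputable section

open scoped BigOperators Matrix.Norms.L2Operator InnerProductSpace ComplexConjugate

namespace Summit.QuantumFields.YangMills.Theorems.Prop7CutoffMassFormRows

open Literature.MathematicalPhysics.QuantumFieldTheory.Balaban1983to89
open Finset
open T4Continuum BlockAveraging
open BlockAveraging (Idx)
open B7Prop1Explicit (disp)
open B5Eq118OneStroke (iterBlockOf)
open B10Eq27TorusAxialLog (holT transl)
open B7TransferAnalyticMean (meanCLM)
open B11Eq103H1Complex (SiteL2K)
open Summit.QuantumFields.YangMills.Theorems.Prop8Chart (emlIterU)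
open Literature.MathematicalPhysics.QuantumFieldTheory.Balaban1983to89.T3ContinuumYM3Torus
open T3SectALandauChart (eta bgUnits)
open T3PrintedRegularMinimiser (RegPr)
open T3PrintedRegularOrbits (sites_eq)
open T3LevelShift (siteShift)
open Summit.QuantumFields.YangMills.Theorems.Prop7SectET3Transport (periodsT3)
open Summit.QuantumFields.YangMills.Theorems.Prop7SectET3HilbertLetters (W₂ toL2S)
open Summit.QuantumFields.YangMills.Theorems.Prop7MassivePropagatorAgmonLetters (topMean_blockConst_smul normSq_lift_topMean_le inner_toL2S_smul_left norm_toL2S_smul_le)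

variable (F : T3Family) {n K : ℕ} (h : n ≤ K) {c₀ c₁ : ℝ} [Fact (0 < c₀)] [Fact (0 < c₁)]
  {ε₀ : ℝ} (hε₀ : 0 < ε₀) (hε7 : 10 ^ 7 * (F.L : ℝ) ^ 3 * ε₀ ≤ 1)
  (V : GaugeField (F.P K) 0 (Matrix.specialUnitaryGroup (Fin 2) ℂ)) (hreg : RegPr F n K ε₀ V)
  (Q'' : SiteL2K ℂ 3 (periodsT3 F K) c₀ W₂ →ₗ[ℂ] (Site (F.P K) (K - n) → Matrix (Fin 2) (Fin 2) ℂ))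
  (hseq : ∀ lam : Site (F.P K) 0 → Matrix (Fin 2) (Fin 2) ℂ, ∃ ns : (j : ℕ) → Site (F.P K) j → Matrix (Fin 2) (Fin 2) ℂ, ns 0 = lam ∧
      (∀ (j : ℕ) (y : Site (F.P K) (j + 1)), ns (j + 1) y = ns j (emb y) - meanCLM (Idx (F.P K)) (Matrix (Fin 2) (Fin 2) ℂ) fun i : Idx (F.P K) =>
        ns j (emb y) - ((holT (emlIterU j (bgUnits F K V)) (emb y) (stairWord i.2.1 (off i.1)) : (Matrix (Fin 2) (Fin 2) ℂ)ˣ) : Matrix (Fin 2) (Fin 2) ℂ) *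
          ns j (transl (emb y) (disp (stairWord i.2.1 (off i.1)))) * (((holT (emlIterU j (bgUnits F K V)) (emb y) (stairWord i.2.1 (off i.1)))⁻¹ : (Matrix (Fin 2) (Fin 2) ℂ)ˣ) : Matrix (Fin 2) (Fin 2) ℂ)) ∧
      ns (K - n) = Q'' (toL2S F K c₀ lam))
  (ι : (Site (F.P K) (K - n) → Matrix (Fin 2) (Fin 2) ℂ) →ₗ[ℂ] SiteL2K ℂ 3 (periodsT3 F n) c₁ W₂)
  (hι : ∀ c, ι c = toL2S F n c₁ (fun z => c (siteShift (sites_eq F n K h) z)))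
  (T : SiteL2K ℂ 3 (periodsT3 F n) c₁ W₂ →ₗ[ℂ] SiteL2K ℂ 3 (periodsT3 F K) c₀ W₂)
  (hT : ∀ (l : SiteL2K ℂ 3 (periodsT3 F K) c₀ W₂) (f : SiteL2K ℂ 3 (periodsT3 F n) c₁ W₂), ⟪ι (Q'' l), f⟫_ℂ = ⟪l, T f⟫_ℂ)

/-! ## §1 (M2′) The cutoff commutes with the mass term up to the in-block oscillation -/

include h hε₀ hε7 hreg hseq hι hT in
/-- ★★ **(M2′) THE MASS COMMUTATOR ROW**: for a real cutoff `χ` with in-block oscillation `|χ(x) − χ_c(B(x))| ≤ θ′` and the multiplier `X = χ·`,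
`|re⟪toL2S z, X(T(ι(Q″(toL2S w)))) − T(ι(Q″(X(toL2S w))))⟫| ≤ (25κ∕4)·θ′·‖toL2S z‖·‖toL2S w‖`, `κ = c₁((L^d)^{K−n})⁻¹∕c₀` — by `hT` both pairings are `⟪ιQ″(·), ιQ″(·)⟫`; the
block-constant part `χ_c∘B` passes through `Q″` EXACTLY (✓`topMean_blockConst_smul`) and is symmetric under the block-constant lift; the remainder carries `(χ − χ_c∘B)`.
[cite: Balaban1985BackgroundPropagators, (3.16) p.393, (3.19) p.393, (3.24) p.394; Balaban1985Averaging, (97) p.32] -/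
theorem abs_re_inner_comm_mass_le (χ : Site (F.P K) 0 → ℝ) (χc : Site (F.P K) (K - n) → ℝ) {θ' : ℝ} (hθ' : 0 ≤ θ')
    (hχblk : ∀ x : Site (F.P K) 0, |χ x - χc (iterBlockOf (K - n) x)| ≤ θ')
    (X : SiteL2K ℂ 3 (periodsT3 F K) c₀ W₂ →ₗ[ℂ] SiteL2K ℂ 3 (periodsT3 F K) c₀ W₂)
    (hX : ∀ l : Site (F.P K) 0 → Matrix (Fin 2) (Fin 2) ℂ, X (toL2S F K c₀ l) = toL2S F K c₀ (fun x => χ x • l x))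
    (z w : Site (F.P K) 0 → Matrix (Fin 2) (Fin 2) ℂ) :
    |RCLike.re ⟪toL2S F K c₀ z, X (T (ι (Q'' (toL2S F K c₀ w)))) - T (ι (Q'' (X (toL2S F K c₀ w))))⟫_ℂ|
      ≤ (25 / 4) * (c₁ * ((((F.P K).L : ℝ) ^ (F.P K).d) ^ (K - n))⁻¹ / c₀) * θ' * ‖toL2S F K c₀ z‖ * ‖toL2S F K c₀ w‖ := by
  have hc₀ : 0 < c₀ := Fact.out
  have hc₁ : 0 < c₁ := Fact.out
  set κ : ℝ := c₁ * ((((F.P K).L : ℝ) ^ (F.P K).d) ^ (K - n))⁻¹ / c₀ with hκ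
  have hκ0 : 0 ≤ κ := by rw [hκ]; have := (F.P K).L_pos; positivity
  -- the two pairings as `⟪ιQ″·, ιQ″·⟫`
  have h1 : ⟪toL2S F K c₀ z, X (T (ι (Q'' (toL2S F K c₀ w))))⟫_ℂ = ⟪ι (Q'' (toL2S F K c₀ (fun x => χ x • z x))), ι (Q'' (toL2S F K c₀ w))⟫_ℂ := by
    obtain ⟨g, hg⟩ : ∃ g, T (ι (Q'' (toL2S F K c₀ w))) = toL2S F K c₀ g := ⟨(toL2S F K c₀).symm _, ((toL2S F K c₀).apply_symm_apply _).symm⟩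
    rw [hg, hX, ← inner_toL2S_smul_left, ← hg, ← hT]
  have h2 : ⟪toL2S F K c₀ z, T (ι (Q'' (X (toL2S F K c₀ w))))⟫_ℂ = ⟪ι (Q'' (toL2S F K c₀ z)), ι (Q'' (toL2S F K c₀ (fun x => χ x • w x)))⟫_ℂ := by
    rw [← hT, hX]
  -- split `χ = χ_c∘B + (χ − χ_c∘B)`
  have hsplit : ∀ y : Site (F.P K) 0 → Matrix (Fin 2) (Fin 2) ℂ,
      ι (Q'' (toL2S F K c₀ (fun x => χ x • y x))) = ι (fun Y => χc Y • Q'' (toL2S F K c₀ y) Y) + ι (Q'' (toL2S F K c₀ (fun x => (χ x - χc (iterBlockOf (K - n) x)) • y x))) := by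
    intro y
    have hfun : (fun x => χ x • y x) = (fun x => χc (iterBlockOf (K - n) x) • y x) + (fun x => (χ x - χc (iterBlockOf (K - n) x)) • y x) := by
      funext x; simp only [Pi.add_apply]; rw [← add_smul]; congr 1; ring
    have hbc : Q'' (toL2S F K c₀ (fun x => χc (iterBlockOf (K - n) x) • y x)) = fun Y => χc Y • Q'' (toL2S F K c₀ y) Y := by
      funext Y; exact topMean_blockConst_smul F V Q'' hseq χc y Y
    rw [hfun, map_add, map_add, map_add, hbc]
  -- the block-constant parts cancel: the lift is symmetric under real coarse multipliers
  have hsym : ⟪ι (fun Y => χc Y • Q'' (toL2S F K c₀ z) Y), ι (Q'' (toL2S F K c₀ w))⟫_ℂ = ⟪ι (Q'' (toL2S F K c₀ z)), ι (fun Y => χc Y • Q'' (toL2S F K c₀ w) Y)⟫_ℂ := by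
    rw [hι, hι, hι, hι]
    exact inner_toL2S_smul_left F (K := n) (c₀ := c₁) (fun zz => χc (siteShift (sites_eq F n K h) zz)) _ _
  -- the remainders
  have hrem : ∀ y : Site (F.P K) 0 → Matrix (Fin 2) (Fin 2) ℂ,
      ‖ι (Q'' (toL2S F K c₀ (fun x => (χ x - χc (iterBlockOf (K - n) x)) • y x)))‖ ≤ Real.sqrt ((25 / 8) * κ) * (θ' * ‖toL2S F K c₀ y‖) := by
    intro y
    have hsq := normSq_lift_topMean_le F V Q'' hseq h (c₁ := c₁) hε₀ hε7 hreg (fun x => (χ x - χc (iterBlockOf (K - n) x)) • y x)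
    rw [← hι, ← hκ] at hsq
    have hsm := norm_toL2S_smul_le F (c₀ := c₀) (fun x => χ x - χc (iterBlockOf (K - n) x)) hθ' hχblk y
    have h3 : ‖ι (Q'' (toL2S F K c₀ (fun x => (χ x - χc (iterBlockOf (K - n) x)) • y x)))‖ ^ 2 ≤ (Real.sqrt ((25 / 8) * κ) * (θ' * ‖toL2S F K c₀ y‖)) ^ 2 := by
      rw [mul_pow, Real.sq_sqrt (by positivity)]
      exact hsq.trans (mul_le_mul_of_nonneg_left (pow_le_pow_left₀ (norm_nonneg _) hsm 2) (by positivity))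
    exact (pow_le_pow_iff_left₀ (norm_nonneg _) (by positivity) two_ne_zero).1 h3
  have hfull : ∀ y : Site (F.P K) 0 → Matrix (Fin 2) (Fin 2) ℂ, ‖ι (Q'' (toL2S F K c₀ y))‖ ≤ Real.sqrt ((25 / 8) * κ) * ‖toL2S F K c₀ y‖ := by
    intro y
    have hsq := normSq_lift_topMean_le F V Q'' hseq h (c₁ := c₁) hε₀ hε7 hreg y
    rw [← hι, ← hκ] at hsq
    have h3 : ‖ι (Q'' (toL2S F K c₀ y))‖ ^ 2 ≤ (Real.sqrt ((25 / 8) * κ) * ‖toL2S F K c₀ y‖) ^ 2 := by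
      rw [mul_pow, Real.sq_sqrt (by positivity)]; exact hsq
    exact (pow_le_pow_iff_left₀ (norm_nonneg _) (by positivity) two_ne_zero).1 h3
  -- assemble
  rw [inner_sub_right, h1, h2, hsplit z, hsplit w, inner_add_left, inner_add_right, hsym]
  have e : ⟪ι (Q'' (toL2S F K c₀ z)), ι (fun Y => χc Y • Q'' (toL2S F K c₀ w) Y)⟫_ℂ
        + ⟪ι (Q'' (toL2S F K c₀ (fun x => (χ x - χc (iterBlockOf (K - n) x)) • z x))), ι (Q'' (toL2S F K c₀ w))⟫_ℂ
        - (⟪ι (Q'' (toL2S F K c₀ z)), ι (fun Y => χc Y • Q'' (toL2S F K c₀ w) Y)⟫_ℂ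
          + ⟪ι (Q'' (toL2S F K c₀ z)), ι (Q'' (toL2S F K c₀ (fun x => (χ x - χc (iterBlockOf (K - n) x)) • w x)))⟫_ℂ)
      = ⟪ι (Q'' (toL2S F K c₀ (fun x => (χ x - χc (iterBlockOf (K - n) x)) • z x))), ι (Q'' (toL2S F K c₀ w))⟫_ℂ
        - ⟪ι (Q'' (toL2S F K c₀ z)), ι (Q'' (toL2S F K c₀ (fun x => (χ x - χc (iterBlockOf (K - n) x)) • w x)))⟫_ℂ := by ring
  rw [e, map_sub]
  have hA : |RCLike.re ⟪ι (Q'' (toL2S F K c₀ (fun x => (χ x - χc (iterBlockOf (K - n) x)) • z x))), ι (Q'' (toL2S F K c₀ w))⟫_ℂ|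
      ≤ (Real.sqrt ((25 / 8) * κ) * (θ' * ‖toL2S F K c₀ z‖)) * (Real.sqrt ((25 / 8) * κ) * ‖toL2S F K c₀ w‖) :=
    (RCLike.abs_re_le_norm _).trans ((norm_inner_le_norm _ _).trans (mul_le_mul (hrem z) (hfull w) (norm_nonneg _) (by positivity)))
  have hB : |RCLike.re ⟪ι (Q'' (toL2S F K c₀ z)), ι (Q'' (toL2S F K c₀ (fun x => (χ x - χc (iterBlockOf (K - n) x)) • w x)))⟫_ℂ|
      ≤ (Real.sqrt ((25 / 8) * κ) * ‖toL2S F K c₀ z‖) * (Real.sqrt ((25 / 8) * κ) * (θ' * ‖toL2S F K c₀ w‖)) :=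
    (RCLike.abs_re_le_norm _).trans ((norm_inner_le_norm _ _).trans (mul_le_mul (hfull z) (hrem w) (norm_nonneg _) (by positivity)))
  have hκs : Real.sqrt ((25 / 8) * κ) * Real.sqrt ((25 / 8) * κ) = (25 / 8) * κ := Real.mul_self_sqrt (by positivity)
  calc _ ≤ _ := abs_sub _ _
    _ ≤ (Real.sqrt ((25 / 8) * κ) * (θ' * ‖toL2S F K c₀ z‖)) * (Real.sqrt ((25 / 8) * κ) * ‖toL2S F K c₀ w‖)
        + (Real.sqrt ((25 / 8) * κ) * ‖toL2S F K c₀ z‖) * (Real.sqrt ((25 / 8) * κ) * (θ' * ‖toL2S F K c₀ w‖)) := add_le_add hA hB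
    _ = 2 * (Real.sqrt ((25 / 8) * κ) * Real.sqrt ((25 / 8) * κ)) * θ' * ‖toL2S F K c₀ z‖ * ‖toL2S F K c₀ w‖ := by ring
    _ = (25 / 4) * κ * θ' * ‖toL2S F K c₀ z‖ * ‖toL2S F K c₀ w‖ := by rw [hκs]; ring

/-! ## §2 (v1.1 append) (M3′-mass): the two mass terms on the cut-off vector, under DISPLAYED two-tower rows; §3 the full `hform` row -/

section TwoBackgrounds

open Summit.QuantumFields.YangMills.Theorems.Prop7SectET3HilbertLetters (DL2 covLapSite)
open Summit.QuantumFields.YangMills.Theorems.Prop7CutoffLaplacianFormRows (abs_re_inner_twisted_laplacian_le)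

variable (U : GaugeField (F.P K) 0 (Matrix.specialUnitaryGroup (Fin 2) ℂ)) (hregU : RegPr F n K ε₀ U)
  (QU : SiteL2K ℂ 3 (periodsT3 F K) c₀ W₂ →ₗ[ℂ] (Site (F.P K) (K - n) → Matrix (Fin 2) (Fin 2) ℂ))
  (hseqU : ∀ lam : Site (F.P K) 0 → Matrix (Fin 2) (Fin 2) ℂ, ∃ ns : (j : ℕ) → Site (F.P K) j → Matrix (Fin 2) (Fin 2) ℂ, ns 0 = lam ∧
      (∀ (j : ℕ) (y : Site (F.P K) (j + 1)), ns (j + 1) y = ns j (emb y) - meanCLM (Idx (F.P K)) (Matrix (Fin 2) (Fin 2) ℂ) fun i : Idx (F.P K) =>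
        ns j (emb y) - ((holT (emlIterU j (bgUnits F K U)) (emb y) (stairWord i.2.1 (off i.1)) : (Matrix (Fin 2) (Fin 2) ℂ)ˣ) : Matrix (Fin 2) (Fin 2) ℂ) *
          ns j (transl (emb y) (disp (stairWord i.2.1 (off i.1)))) * (((holT (emlIterU j (bgUnits F K U)) (emb y) (stairWord i.2.1 (off i.1)))⁻¹ : (Matrix (Fin 2) (Fin 2) ℂ)ˣ) : Matrix (Fin 2) (Fin 2) ℂ)) ∧
      ns (K - n) = QU (toL2S F K c₀ lam))
  (TU : SiteL2K ℂ 3 (periodsT3 F n) c₁ W₂ →ₗ[ℂ] SiteL2K ℂ 3 (periodsT3 F K) c₀ W₂)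
  (hTU : ∀ (l : SiteL2K ℂ 3 (periodsT3 F K) c₀ W₂) (f : SiteL2K ℂ 3 (periodsT3 F n) c₁ W₂), ⟪ι (QU l), f⟫_ℂ = ⟪l, TU f⟫_ℂ)

include h hε₀ hε7 hregU hseqU hι hT hTU in
/-- ★★ **(M3′-mass) THE TWO MASS TERMS ON THE CUT-OFF VECTOR** (`V`'s mean `Q''`∕adjoint `T`, `U`'s mean `QU`∕adjoint `TU`, same lift `ι`): under the DISPLAYED two-tower rows
`hQw : ‖ι(Q''(toL2S(χ·y))) − ι(QU(toL2S(χ·y)))‖ ≤ δ_Q‖toL2S y‖` (the means agree on χ-cut fields — the site twin of (L5c)'s framed-copy row) and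
`hQz : ‖⟪ι(Q''(toL2S y)) − ι(QU(toL2S y)), ι(Q''(toL2S(χ·y′)))⟫‖ ≤ δ_Q·√(25κ∕8)·‖toL2S y‖‖toL2S y′‖` (its block-local pairing twin),
`|re⟪toL2S z, T(ι(Q''(toL2S(χ·w)))) − TU(ι(QU(toL2S(χ·w))))⟫| ≤ 2√(25κ∕8)·δ_Q·‖toL2S z‖‖toL2S w‖`. [cite: Balaban1985BackgroundPropagators, (3.16) p.393, (3.24) p.394; Balaban1985Averaging, (97) p.32] -/
theorem abs_re_inner_mass_sub_mass_le (χ : Site (F.P K) 0 → ℝ) {δQ : ℝ}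
    (hQw : ∀ y : Site (F.P K) 0 → Matrix (Fin 2) (Fin 2) ℂ,
      ‖ι (Q'' (toL2S F K c₀ (fun x => χ x • y x))) - ι (QU (toL2S F K c₀ (fun x => χ x • y x)))‖ ≤ δQ * ‖toL2S F K c₀ y‖)
    (hQz : ∀ y y' : Site (F.P K) 0 → Matrix (Fin 2) (Fin 2) ℂ,
      ‖⟪ι (Q'' (toL2S F K c₀ y)) - ι (QU (toL2S F K c₀ y)), ι (Q'' (toL2S F K c₀ (fun x => χ x • y' x)))⟫_ℂ‖
        ≤ δQ * Real.sqrt ((25 / 8) * (c₁ * ((((F.P K).L : ℝ) ^ (F.P K).d) ^ (K - n))⁻¹ / c₀)) * ‖toL2S F K c₀ y‖ * ‖toL2S F K c₀ y'‖)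
    (z w : Site (F.P K) 0 → Matrix (Fin 2) (Fin 2) ℂ) :
    |RCLike.re ⟪toL2S F K c₀ z, T (ι (Q'' (toL2S F K c₀ (fun x => χ x • w x)))) - TU (ι (QU (toL2S F K c₀ (fun x => χ x • w x))))⟫_ℂ|
      ≤ 2 * Real.sqrt ((25 / 8) * (c₁ * ((((F.P K).L : ℝ) ^ (F.P K).d) ^ (K - n))⁻¹ / c₀)) * δQ * ‖toL2S F K c₀ z‖ * ‖toL2S F K c₀ w‖ := by
  have hc₀ : 0 < c₀ := Fact.out
  have hc₁ : 0 < c₁ := Fact.out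
  set κ : ℝ := c₁ * ((((F.P K).L : ℝ) ^ (F.P K).d) ^ (K - n))⁻¹ / c₀ with hκ
  have hκ0 : 0 ≤ κ := by rw [hκ]; have := (F.P K).L_pos; positivity
  set s : ℝ := Real.sqrt ((25 / 8) * κ) with hs
  have hs0 : 0 ≤ s := Real.sqrt_nonneg _
  set CW := toL2S F K c₀ (fun x => χ x • w x) with hCW
  -- both pairings as `⟪ι·, ι·⟫`, then split
  have hmain : ⟪toL2S F K c₀ z, T (ι (Q'' CW)) - TU (ι (QU CW))⟫_ℂ
      = ⟪ι (Q'' (toL2S F K c₀ z)) - ι (QU (toL2S F K c₀ z)), ι (Q'' CW)⟫_ℂ + ⟪ι (QU (toL2S F K c₀ z)), ι (Q'' CW) - ι (QU CW)⟫_ℂ := by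
    rw [inner_sub_right, ← hT, ← hTU, inner_sub_left, inner_sub_right]; ring
  have hUz : ‖ι (QU (toL2S F K c₀ z))‖ ≤ s * ‖toL2S F K c₀ z‖ := by
    have hsq := normSq_lift_topMean_le F U QU hseqU h (c₁ := c₁) hε₀ hε7 hregU z
    rw [← hι, ← hκ] at hsq
    have h3 : ‖ι (QU (toL2S F K c₀ z))‖ ^ 2 ≤ (s * ‖toL2S F K c₀ z‖) ^ 2 := by rw [mul_pow, hs, Real.sq_sqrt (by positivity)]; exact hsq
    exact (pow_le_pow_iff_left₀ (norm_nonneg _) (by positivity) two_ne_zero).1 h3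
  rw [hmain, map_add]
  have hA : |RCLike.re ⟪ι (Q'' (toL2S F K c₀ z)) - ι (QU (toL2S F K c₀ z)), ι (Q'' CW)⟫_ℂ| ≤ δQ * s * ‖toL2S F K c₀ z‖ * ‖toL2S F K c₀ w‖ :=
    (RCLike.abs_re_le_norm _).trans (hQz z w)
  have hB : |RCLike.re ⟪ι (QU (toL2S F K c₀ z)), ι (Q'' CW) - ι (QU CW)⟫_ℂ| ≤ (s * ‖toL2S F K c₀ z‖) * (δQ * ‖toL2S F K c₀ w‖) :=
    (RCLike.abs_re_le_norm _).trans ((norm_inner_le_norm _ _).trans (mul_le_mul hUz (hQw w) (norm_nonneg _) (by positivity)))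
  calc _ ≤ _ := abs_add_le _ _
    _ ≤ δQ * s * ‖toL2S F K c₀ z‖ * ‖toL2S F K c₀ w‖ + (s * ‖toL2S F K c₀ z‖) * (δQ * ‖toL2S F K c₀ w‖) := add_le_add hA hB
    _ = 2 * s * δQ * ‖toL2S F K c₀ z‖ * ‖toL2S F K c₀ w‖ := by ring

include h hε₀ hε7 hreg hseq hregU hseqU hι hT hTU in
/-- ★★★ **THE ONE EXPORTED ROW (routeR-w3's docking ask): the `hform` binder of ✓`Prop7CutoffResolventComparison.norm_inv_cutoff_comm_le_of_form` for the MASSIVE systems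
`A_U = Δ_U + a·TU(ι(QU·))`, `A_V = Δ_V + a·T(ι(Q''·))` and the cutoff `X = χ·`**: under the hypotheses of ✓`abs_re_inner_twisted_laplacian_le` (block steps `θ`, `|χ| ≤ 1`,
`‖U_b − V_b‖ ≤ δη` on bonds meeting `supp χ`), the in-block oscillation `θ′` and the two-tower rows `δ_Q`,
`|re⟪toL2S z, X(A_V(toL2S w)) − A_U(X(toL2S w))⟫| ≤ (c₁'‖D_V(toL2S w)‖ + c₀'‖toL2S w‖)·(‖D_U(toL2S z)‖ + ‖toL2S z‖)` with `c₁' = c`, `c₀' = c + a·((25κ∕4)θ′ + 2√(25κ∕8)δ_Q)`,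
`c = √3η⁻¹θ + √24δ + 2(√3η⁻¹θ)(√24δ)` — K-free at `θ ≤ η∕(R″−R′)`, `δ = 6R″ε₀`, `c₁ = c₀L^{3(K−n)}`. [cite: Balaban1985BackgroundPropagators, Thm 3.3 p.399, (3.100)–(3.105) pp.413–414, (3.24) p.394] -/
theorem abs_re_inner_twisted_massive_le (χ : Site (F.P K) 0 → ℝ) (χc : Site (F.P K) (K - n) → ℝ) {θ θ' δ δQ : ℝ} (hθ : 0 ≤ θ) (hθ' : 0 ≤ θ') (hδ : 0 ≤ δ) (hδQ : 0 ≤ δQ)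
    (hχ1 : ∀ x, |χ x| ≤ 1) (hχ : ∀ (x : Site (F.P K) 0) (μ : Fin 3), |χ (x.shift μ) - χ x| ≤ θ)
    (hχblk : ∀ x : Site (F.P K) 0, |χ x - χc (iterBlockOf (K - n) x)| ≤ θ')
    (hUV : ∀ b : PBond (F.P K) 0, (χ b.tgt ≠ 0 ∨ χ b.src ≠ 0) →
      ‖((bgUnits F K U b : (Matrix (Fin 2) (Fin 2) ℂ)ˣ) : Matrix (Fin 2) (Fin 2) ℂ) - ((bgUnits F K V b : (Matrix (Fin 2) (Fin 2) ℂ)ˣ) : Matrix (Fin 2) (Fin 2) ℂ)‖ ≤ δ * eta F n K)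
    (hQw : ∀ y : Site (F.P K) 0 → Matrix (Fin 2) (Fin 2) ℂ,
      ‖ι (Q'' (toL2S F K c₀ (fun x => χ x • y x))) - ι (QU (toL2S F K c₀ (fun x => χ x • y x)))‖ ≤ δQ * ‖toL2S F K c₀ y‖)
    (hQz : ∀ y y' : Site (F.P K) 0 → Matrix (Fin 2) (Fin 2) ℂ,
      ‖⟪ι (Q'' (toL2S F K c₀ y)) - ι (QU (toL2S F K c₀ y)), ι (Q'' (toL2S F K c₀ (fun x => χ x • y' x)))⟫_ℂ‖
        ≤ δQ * Real.sqrt ((25 / 8) * (c₁ * ((((F.P K).L : ℝ) ^ (F.P K).d) ^ (K - n))⁻¹ / c₀)) * ‖toL2S F K c₀ y‖ * ‖toL2S F K c₀ y'‖)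
    {a : ℝ} (ha : 0 ≤ a)
    (X : SiteL2K ℂ 3 (periodsT3 F K) c₀ W₂ →ₗ[ℂ] SiteL2K ℂ 3 (periodsT3 F K) c₀ W₂)
    (hX : ∀ l : Site (F.P K) 0 → Matrix (Fin 2) (Fin 2) ℂ, X (toL2S F K c₀ l) = toL2S F K c₀ (fun x => χ x • l x))
    (z w : Site (F.P K) 0 → Matrix (Fin 2) (Fin 2) ℂ) :
    |RCLike.re ⟪toL2S F K c₀ z,
        X (covLapSite F n K c₀ V (toL2S F K c₀ w) + (a : ℂ) • T (ι (Q'' (toL2S F K c₀ w))))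
          - (covLapSite F n K c₀ U (X (toL2S F K c₀ w)) + (a : ℂ) • TU (ι (QU (X (toL2S F K c₀ w)))))⟫_ℂ|
      ≤ ((Real.sqrt 3 * (eta F n K)⁻¹ * θ + Real.sqrt 24 * δ + 2 * (Real.sqrt 3 * (eta F n K)⁻¹ * θ) * (Real.sqrt 24 * δ)) * ‖DL2 F n K c₀ V (toL2S F K c₀ w)‖
          + ((Real.sqrt 3 * (eta F n K)⁻¹ * θ + Real.sqrt 24 * δ + 2 * (Real.sqrt 3 * (eta F n K)⁻¹ * θ) * (Real.sqrt 24 * δ))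
              + a * ((25 / 4) * (c₁ * ((((F.P K).L : ℝ) ^ (F.P K).d) ^ (K - n))⁻¹ / c₀) * θ'
                     + 2 * Real.sqrt ((25 / 8) * (c₁ * ((((F.P K).L : ℝ) ^ (F.P K).d) ^ (K - n))⁻¹ / c₀)) * δQ)) * ‖toL2S F K c₀ w‖)
        * (‖DL2 F n K c₀ U (toL2S F K c₀ z)‖ + ‖toL2S F K c₀ z‖) := by
  have hη : 0 < eta F n K := T3SectALandauChart.eta_pos F n K
  -- split into Laplacian + mass-commutator + mass-difference
  have hXsmul : ∀ v : SiteL2K ℂ 3 (periodsT3 F K) c₀ W₂, X ((a : ℂ) • v) = (a : ℂ) • X v := fun v => map_smul X _ v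
  have hsplit : X (covLapSite F n K c₀ V (toL2S F K c₀ w) + (a : ℂ) • T (ι (Q'' (toL2S F K c₀ w))))
        - (covLapSite F n K c₀ U (X (toL2S F K c₀ w)) + (a : ℂ) • TU (ι (QU (X (toL2S F K c₀ w)))))
      = (X (covLapSite F n K c₀ V (toL2S F K c₀ w)) - covLapSite F n K c₀ U (X (toL2S F K c₀ w)))
        + (a : ℂ) • ((X (T (ι (Q'' (toL2S F K c₀ w)))) - T (ι (Q'' (X (toL2S F K c₀ w)))))
          + (T (ι (Q'' (toL2S F K c₀ (fun x => χ x • w x)))) - TU (ι (QU (toL2S F K c₀ (fun x => χ x • w x)))))) := by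
    rw [map_add, hXsmul, hX w]; module
  rw [hsplit, inner_add_right, map_add, inner_smul_right]
  have hre : RCLike.re ((a : ℂ) * ⟪toL2S F K c₀ z, (X (T (ι (Q'' (toL2S F K c₀ w)))) - T (ι (Q'' (X (toL2S F K c₀ w)))))
      + (T (ι (Q'' (toL2S F K c₀ (fun x => χ x • w x)))) - TU (ι (QU (toL2S F K c₀ (fun x => χ x • w x)))))⟫_ℂ)
      = a * RCLike.re ⟪toL2S F K c₀ z, (X (T (ι (Q'' (toL2S F K c₀ w)))) - T (ι (Q'' (X (toL2S F K c₀ w)))))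
      + (T (ι (Q'' (toL2S F K c₀ (fun x => χ x • w x)))) - TU (ι (QU (toL2S F K c₀ (fun x => χ x • w x)))))⟫_ℂ := by
    rw [RCLike.re_to_complex, Complex.re_ofReal_mul]; rfl
  rw [hre, inner_add_right, map_add]
  have h1 := abs_re_inner_twisted_laplacian_le F U V χ hθ hδ hχ1 hχ hUV X hX z w
  have h2 := abs_re_inner_comm_mass_le F h hε₀ hε7 V hreg Q'' hseq ι hι T hT χ χc hθ' hχblk X hX z w
  have h3 := abs_re_inner_mass_sub_mass_le F h hε₀ hε7 Q'' ι hι T hT U hregU QU hseqU TU hTU χ hQw hQz z w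
  set A := RCLike.re ⟪toL2S F K c₀ z, X (covLapSite F n K c₀ V (toL2S F K c₀ w)) - covLapSite F n K c₀ U (X (toL2S F K c₀ w))⟫_ℂ
  set B := RCLike.re ⟪toL2S F K c₀ z, X (T (ι (Q'' (toL2S F K c₀ w)))) - T (ι (Q'' (X (toL2S F K c₀ w))))⟫_ℂ
  set C := RCLike.re ⟪toL2S F K c₀ z, T (ι (Q'' (toL2S F K c₀ (fun x => χ x • w x)))) - TU (ι (QU (toL2S F K c₀ (fun x => χ x • w x))))⟫_ℂ
  set cc : ℝ := Real.sqrt 3 * (eta F n K)⁻¹ * θ + Real.sqrt 24 * δ + 2 * (Real.sqrt 3 * (eta F n K)⁻¹ * θ) * (Real.sqrt 24 * δ)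
  set κ : ℝ := c₁ * ((((F.P K).L : ℝ) ^ (F.P K).d) ^ (K - n))⁻¹ / c₀
  set s : ℝ := Real.sqrt ((25 / 8) * κ)
  set nZ := ‖toL2S F K c₀ z‖
  set nW := ‖toL2S F K c₀ w‖
  set dVW := ‖DL2 F n K c₀ V (toL2S F K c₀ w)‖
  set dUZ := ‖DL2 F n K c₀ U (toL2S F K c₀ z)‖
  have hZ0 : 0 ≤ nZ := norm_nonneg _
  have hW0 : 0 ≤ nW := norm_nonneg _
  have hdUZ : 0 ≤ dUZ := norm_nonneg _
  have hBC : |a * (B + C)| ≤ a * ((25 / 4) * κ * θ' * nZ * nW + 2 * s * δQ * nZ * nW) := by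
    rw [abs_mul, abs_of_nonneg ha]
    exact mul_le_mul_of_nonneg_left ((abs_add_le _ _).trans (add_le_add h2 h3)) ha
  have hmass_le : a * ((25 / 4) * κ * θ' * nZ * nW + 2 * s * δQ * nZ * nW) ≤ a * ((25 / 4) * κ * θ' + 2 * s * δQ) * nW * (dUZ + nZ) := by
    have e : a * ((25 / 4) * κ * θ' * nZ * nW + 2 * s * δQ * nZ * nW) = a * ((25 / 4) * κ * θ' + 2 * s * δQ) * nW * nZ := by ring
    rw [e]
    have hcoef : 0 ≤ a * ((25 / 4) * κ * θ' + 2 * s * δQ) * nW := by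
      have hκ0 : 0 ≤ κ := by have := (F.P K).L_pos; have : (0:ℝ) < c₀ := Fact.out; have : (0:ℝ) < c₁ := Fact.out; positivity
      have hs0 : 0 ≤ s := Real.sqrt_nonneg _
      positivity
    exact mul_le_mul_of_nonneg_left (by linarith) hcoef
  calc |A + a * (B + C)| ≤ |A| + |a * (B + C)| := abs_add_le _ _
    _ ≤ (cc * dVW + cc * nW) * (dUZ + nZ) + a * ((25 / 4) * κ * θ' + 2 * s * δQ) * nW * (dUZ + nZ) := add_le_add h1 (hBC.trans hmass_le)
    _ = (cc * dVW + (cc + a * ((25 / 4) * κ * θ' + 2 * s * δQ)) * nW) * (dUZ + nZ) := by ring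

end TwoBackgrounds

end Summit.QuantumFields.YangMills.Theorems.Prop7CutoffMassFormRows

end
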